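import Mathlib.MeasureTheory.Function.Jacobian
import Literature.Geometry.Lorentzian.InverseMeanCurvatureFlowAECalculus
import HarnessLib

/-!
# Inverse mean curvature flow I — proofs: functions with a.e.-vanishing slope are locally constant

Sorry-free continuation of `InverseMeanCurvatureFlowAECalculus.lean` (Huisken–Ilmanen,
J. Differential Geom. 59 (2001), §§1–2). The step "`|∇u| = 0` a.e. on the open set `W`, hence `u`
is constant on each connected component of `W`" of the proofs of Lemma 1.4 (ii) and Thm. 2.2 (i),
for locally Lipschitz `u` on a Riemannian `3`-manifold. Everything is proved; there are no
definitions and no named facts.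

* `Real.eq_of_lipschitzOnWith_of_ae_hasDerivAt_zero` — a Lipschitz function of one variable with
  a.e.-zero derivative on `(a, b)` has `g b = g a` (image measure: Sard in dimension one, Mathlib's
  `addHaar_image_eq_zero_of_det_fderivWithin_eq_zero`, plus `μH¹(g N) ≤ K μH¹ N` for the null
  exceptional set, against `[g a, g b] ⊆ g [a, b]`).
* `eq_on_ball_of_ae_fderiv_eq_zero` — a Lipschitz `F : ℝ³ → ℝ` with `DF = 0` a.e. on an open
  set is locally constant there (disintegration of Lebesgue measure along lines, Mathlib's
  `ae_ae_add_linearMap_mem_iff`, and the one-variable lemma on a.e. line).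
* `volume_eq_zero_of_riemannianMeasure_source_inter_preimage_eq_zero` — `μ_h`-null sets are
  Lebesgue-null in charts (the density `√det h_{ij}` is positive), converse to
  `riemannianMeasure_source_inter_preimage_eq_zero`.
* `IsLocLipschitzOn.eventuallyEq_const_of_ae_mfderiv_eq_zero` /
  `…_of_ae_gradNorm_eq_zero` — locally Lipschitz `u` on an open `W` with `du = 0` (`|∇u| = 0`)
  a.e. on `W` is constant near each point of `W` (`gradNorm_eq_zero_iff`: `|∇u|(p) = 0 ↔ du_p = 0`);
  `IsLocLipschitzOn.eq_of_isPreconnected_of_ae_gradNorm_eq_zero` — hence constant on every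
  preconnected subset of `W`.

## References

* G. Huisken, T. Ilmanen, *The inverse mean curvature flow and the Riemannian Penrose
  inequality*, J. Differential Geom. 59 (2001) 353–437: proofs of Lemma 1.4 (ii) and Thm. 2.2 (i).
* H. Federer, *Geometric Measure Theory*, Springer 1969, 2.10.11, 3.2.3.
* L. C. Evans, R. F. Gariepy, *Measure theory and fine properties of functions*, CRC 1992, §4.2.
-/

noncomputable section

open Bundle Set Manifold TopologicalSpace Filter MeasureTheory Function Metric
open scoped ContDiff Topology ENNReal NNReal Manifold Real

namespace Literature.Geometry.Lorentzian

open PseudoRiemannianMetric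

/-! ### Dimension one: Lipschitz functions with a.e.-zero derivative are constant -/

section OneDim

/-- **A Lipschitz function of one variable with a.e.-vanishing derivative is constant**: if `g` is
Lipschitz on `[a, b]` and `g'(t) = 0` for a.e. `t ∈ (a, b)`, then `g b = g a`. Proof by the image
measure: `[g a, g b] ⊆ g([a, b])` (intermediate values), the image of the set where `g' = 0` is
Lebesgue-null (Sard in dimension one, Mathlib's `addHaar_image_eq_zero_of_det_fderivWithin_eq_zero`)
and the image of the exceptional null set is null (`μH¹(g N) ≤ K μH¹(N)`). Federer 1969, 2.10.11
and 3.2.3. [folklore] -/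
theorem Real.eq_of_lipschitzOnWith_of_ae_hasDerivAt_zero {g : ℝ → ℝ} {a b : ℝ} (hab : a ≤ b)
    {K : ℝ≥0} (hg : LipschitzOnWith K g (Icc a b))
    (h0 : ∀ᵐ t ∂(volume : Measure ℝ), t ∈ Ioo a b → HasDerivAt g 0 t) : g b = g a := by
  set Z := {t | t ∈ Ioo a b ∧ HasDerivAt g 0 t} with hZ
  set N := Icc a b \ Z with hN
  -- the exceptional set is null
  have hN0 : volume N = 0 := by
    have h1 : volume {t | ¬ (t ∈ Ioo a b → HasDerivAt g 0 t)} = 0 := ae_iff.1 h0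
    have h2 : volume ({a, b} : Set ℝ) = 0 := (Set.toFinite _).measure_zero volume
    refine measure_mono_null (fun t ht ↦ ?_) (measure_union_null h1 h2)
    obtain ⟨htI, htZ⟩ := ht
    by_cases hta : t = a
    · exact Or.inr (by simp [hta])
    by_cases htb : t = b
    · exact Or.inr (by simp [htb])
    have htoo : t ∈ Ioo a b := ⟨lt_of_le_of_ne htI.1 (Ne.symm hta), lt_of_le_of_ne htI.2 htb⟩
    exact Or.inl fun himp ↦ htZ ⟨htoo, himp htoo⟩
  -- the image of `Z` is null (Sard in dimension one)
  have hZ0 : volume (g '' Z) = 0 := by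
    have hdet : (ContinuousLinearMap.smulRight (1 : ℝ →L[ℝ] ℝ) (0 : ℝ)).det = 0 := by
      have : ContinuousLinearMap.smulRight (1 : ℝ →L[ℝ] ℝ) (0 : ℝ) = 0 := by ext; simp
      rw [this]
      simp [ContinuousLinearMap.det]
    exact addHaar_image_eq_zero_of_det_fderivWithin_eq_zero volume
      (f' := fun _ ↦ ContinuousLinearMap.smulRight (1 : ℝ →L[ℝ] ℝ) (0 : ℝ))
      (fun t ht ↦ (hasDerivAt_iff_hasFDerivAt.1 ht.2).hasFDerivWithinAt) (fun _ _ ↦ hdet)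
  -- the image of `N` is null (Lipschitz maps do not increase `μH¹` by more than `K`)
  have hgN0 : volume (g '' N) = 0 := by
    rw [← hausdorffMeasure_real, ← nonpos_iff_eq_zero]
    have h1 := (hg.mono (sdiff_subset : N ⊆ Icc a b)).hausdorffMeasure_image_le zero_le_one
    rw [ENNReal.rpow_one] at h1
    refine h1.trans ?_
    rw [hausdorffMeasure_real, hN0, mul_zero]
  -- hence the image of `[a, b]` is null, while it contains `[g a, g b]`
  have himage : volume (g '' Icc a b) = 0 := by
    have hsplit : Icc a b ⊆ Z ∪ N := fun t ht ↦ by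
      by_cases htZ : t ∈ Z
      · exact Or.inl htZ
      · exact Or.inr ⟨ht, htZ⟩
    refine measure_mono_null ((image_mono hsplit).trans (image_union _ _ _).subset) ?_
    exact measure_union_null hZ0 hgN0
  have hsub : uIcc (g a) (g b) ⊆ g '' Icc a b := by
    have := intermediate_value_uIcc (f := g) (a := a) (b := b) (by rw [uIcc_of_le hab]; exact hg.continuousOn)
    rwa [uIcc_of_le hab] at this
  have hvol : volume (uIcc (g a) (g b)) = 0 := measure_mono_null hsub himage
  rw [Real.volume_interval, ENNReal.ofReal_eq_zero, abs_nonpos_iff, sub_eq_zero] at hvol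
  exact hvol

end OneDim

/-! ### Euclidean space: Lipschitz functions with a.e.-zero gradient are locally constant -/

section Euclidean

/-- Lines `t ↦ y + t w` are Lipschitz with constant `‖w‖`. [folklore] -/
theorem lipschitzWith_line (y w : E3) : LipschitzWith ‖w‖₊ fun t : ℝ ↦ y + t • w := by
  refine LipschitzWith.of_dist_le_mul fun s t ↦ ?_
  rw [dist_add_left, dist_eq_norm, ← sub_smul, norm_smul, Real.norm_eq_abs, ← Real.dist_eq,
    mul_comm]
  rfl

/-- **Lipschitz functions on `ℝ³` with a.e.-vanishing gradient are locally constant.** If `F` is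
Lipschitz, `DF = 0` a.e. on the open set `S`, and the ball `B(y₀, r)` lies in `S`, then `F` is
constant on `B(y₀, r/2)`. Proof: for a fixed `w` with `‖w‖ < r/2`, for a.e. `z` the gradient
vanishes at a.e. point of the line `z + ℝw` (disintegration of Lebesgue measure along lines,
Mathlib's `ae_ae_add_linearMap_mem_iff`), so `t ↦ F(z + t w)` is constant on `[0, 1]` when
`z ∈ B(y₀, r/2)` (`Real.eq_of_lipschitzOnWith_of_ae_hasDerivAt_zero`); the closed set
`{F(· + w) = F}` thus has full measure in the ball, hence contains it. [folklore] -/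
theorem eq_on_ball_of_ae_fderiv_eq_zero {F : E3 → ℝ} {K : ℝ≥0} (hF : LipschitzWith K F)
    {S : Set E3} (hS : IsOpen S)
    (h0 : ∀ᵐ y ∂(volume : Measure E3), y ∈ S → fderiv ℝ F y = 0)
    {y₀ : E3} {r : ℝ} (hB : ball y₀ r ⊆ S) :
    ∀ y ∈ ball y₀ (r / 2), F y = F y₀ := by
  -- the good set and its measurability
  set G := {y : E3 | y ∈ S → (DifferentiableAt ℝ F y ∧ fderiv ℝ F y = 0)} with hG
  have hGm : MeasurableSet G := by
    have : G = Sᶜ ∪ ({y | DifferentiableAt ℝ F y} ∩ (fderiv ℝ F) ⁻¹' {0}) := by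
      ext y
      simp only [hG, mem_setOf_eq, mem_union, mem_compl_iff, mem_inter_iff, mem_preimage,
        mem_singleton_iff]
      tauto
    rw [this]
    exact hS.measurableSet.compl.union ((measurableSet_of_differentiableAt ℝ F).inter
      (measurable_fderiv ℝ F (measurableSet_singleton 0)))
  have hGae : ∀ᵐ y ∂(volume : Measure E3), y ∈ G := by
    filter_upwards [h0, hF.ae_differentiableAt (μ := volume)] with y hy hyd hyS
    exact ⟨hyd, hy hyS⟩
  -- translation by a fixed small vector `w`
  have key : ∀ w : E3, ‖w‖ < r / 2 → ∀ y ∈ ball y₀ (r / 2), F (y + w) = F y := by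
    intro w hw
    have hlines : ∀ᵐ y ∂(volume : Measure E3), ∀ᵐ t ∂(volume : Measure ℝ),
        y + (LinearMap.toSpanSingleton ℝ E3 w) t ∈ G :=
      (ae_ae_add_linearMap_mem_iff (LinearMap.toSpanSingleton ℝ E3 w) (volume : Measure ℝ)
        (volume : Measure E3) hGm).2 hGae
    -- the closed set `A = {F (· + w) = F}` has full measure in the ball
    set A := {y : E3 | F (y + w) = F y} with hA
    have hAc : IsClosed A :=
      isClosed_eq (hF.continuous.comp (continuous_id.add continuous_const)) hF.continuous
    have hAae : ∀ᵐ y ∂(volume : Measure E3), y ∈ ball y₀ (r / 2) → y ∈ A := by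
      filter_upwards [hlines] with z hz hzB
      simp only [LinearMap.toSpanSingleton_apply] at hz
      -- the line function `g t = F (z + t w)` is Lipschitz with a.e.-zero derivative on `(0, 1)`
      have hg : LipschitzOnWith (K * ‖w‖₊) (fun t : ℝ ↦ F (z + t • w)) (Icc 0 1) :=
        (hF.comp (lipschitzWith_line z w)).lipschitzOnWith
      have hderiv : ∀ᵐ t ∂(volume : Measure ℝ), t ∈ Ioo (0 : ℝ) 1 →
          HasDerivAt (fun t : ℝ ↦ F (z + t • w)) 0 t := by
        filter_upwards [hz] with t ht htI
        have hzt : z + t • w ∈ S := by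
          refine hB ?_
          rw [mem_ball, dist_eq_norm]
          have hzB' : ‖z - y₀‖ < r / 2 := by rwa [mem_ball, dist_eq_norm] at hzB
          calc ‖z + t • w - y₀‖ = ‖(z - y₀) + t • w‖ := by abel_nf
            _ ≤ ‖z - y₀‖ + ‖t • w‖ := norm_add_le _ _
            _ < r / 2 + r / 2 := by
                gcongr
                rw [norm_smul, Real.norm_eq_abs, abs_of_pos htI.1]
                calc t * ‖w‖ ≤ 1 * ‖w‖ := by gcongr; exact htI.2.le
                  _ = ‖w‖ := one_mul _
                  _ < r / 2 := hw
            _ = r := by ring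
        obtain ⟨hd, hf0⟩ := ht hzt
        have hl : HasDerivAt (fun t : ℝ ↦ z + t • w) w t := by
          simpa using ((hasDerivAt_id t).smul_const w).const_add z
        have := hd.hasFDerivAt.comp_hasDerivAt t hl
        rwa [hf0, zero_apply] at this
      have h1 := Real.eq_of_lipschitzOnWith_of_ae_hasDerivAt_zero zero_le_one hg hderiv
      simp only [one_smul, zero_smul, add_zero] at h1
      exact h1
    -- a closed set of full measure in an open ball contains the ball
    intro y hy
    by_contra hyA
    have hopen : IsOpen (ball y₀ (r / 2) \ A) := isOpen_ball.sdiff hAc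
    have hpos : 0 < volume (ball y₀ (r / 2) \ A) := hopen.measure_pos volume ⟨y, hy, hyA⟩
    have hnull : volume (ball y₀ (r / 2) \ A) = 0 := by
      rw [measure_eq_zero_iff_ae_notMem]
      filter_upwards [hAae] with z hz hzD
      exact hzD.2 (hz hzD.1)
    exact hpos.ne' hnull
  intro y hy
  have hw : ‖y - y₀‖ < r / 2 := by rwa [mem_ball, dist_eq_norm] at hy
  have := key (y - y₀) hw y₀ (mem_ball_self (by linarith [norm_nonneg (y - y₀)]))
  rwa [add_sub_cancel] at this

end Euclidean

variable {X : Type*} [TopologicalSpace X] [ChartedSpace E3 X] [IsManifold (𝓡 3) ∞ X]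

/-! ### Transfer to the manifold -/

section Manifold

variable (h : ContMDiffRiemannianMetric (𝓡 3) ∞ E3 (TangentSpace (𝓡 3) : X → Type _))

/-- If `du_p = 0` then the chart representative has zero Fréchet derivative at `φ p`
(`du_p(∂ᵢ) = ∂ᵢ(u ∘ φ⁻¹)(φ p)`, and the `bᵢ` form a basis of `ℝ³`). [folklore] -/
theorem fderiv_chart_eq_zero_of_mfderiv_eq_zero {u : X → ℝ} {x₀ p : X}
    (hp : p ∈ (chartAt E3 x₀).source) (h0 : mfderiv (𝓡 3) 𝓘(ℝ, ℝ) u p = 0) :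
    fderiv ℝ (u ∘ (extChartAt (𝓡 3) x₀).symm) (extChartAt (𝓡 3) x₀ p) = 0 := by
  refine eq_zero_of_forall_apply_basisFun_eq_zero fun i ↦ ?_
  have := mfderiv_apply_localFrame (EuclideanSpace.basisFun (Fin 3) ℝ).toBasis (u := u) hp i
  rw [h0] at this
  rw [OrthonormalBasis.coe_toBasis] at this
  rw [← this]
  rfl

/-- `|∇u|(p) = 0` iff `du_p = 0` (`h⁻¹` is positive definite on covectors: `h⁻¹(α, α) = ‖♯α‖²`
and `♯` is injective). [folklore] -/
theorem gradNorm_eq_zero_iff {u : X → ℝ} {p : X} :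
    gradNorm h u p = 0 ↔ mfderiv (𝓡 3) 𝓘(ℝ, ℝ) u p = 0 := by
  constructor
  · intro h0
    letI : RiemannianBundle (fun x : X ↦ TangentSpace (𝓡 3) x) :=
      ⟨h.toContinuousRiemannianMetric.toRiemannianMetric⟩
    set α : Module.Dual ℝ (TangentSpace (𝓡 3) p) := (mfderiv (𝓡 3) 𝓘(ℝ, ℝ) u p).toLinearMap
      with hα
    have h1 : (ofRiemannian h).innerDual p α α ≤ 0 := Real.sqrt_eq_zero'.1 h0
    have h2 : inner ℝ ((ofRiemannian h).sharp p α) ((ofRiemannian h).sharp p α) ≤ (0 : ℝ) := by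
      have h3 : (ofRiemannian h).innerDual p α α =
          h.inner p ((ofRiemannian h).sharp p α) ((ofRiemannian h).sharp p α) := by
        rw [innerDual_eq_val_sharp_sharp, val_ofRiemannian]
      rw [h3] at h1
      exact h1
    have h4 : (ofRiemannian h).sharp p α = 0 :=
      inner_self_eq_zero.1 (le_antisymm h2 real_inner_self_nonneg)
    have h5 : α = 0 := by
      have := congrArg ((ofRiemannian h).flat p) h4
      rwa [flat_sharp, map_zero] at this
    apply ContinuousLinearMap.coe_injective
    rw [← hα, h5]
    rfl
  · intro h0
    have h1 : ((mfderiv (𝓡 3) 𝓘(ℝ, ℝ) u p).toLinearMap : Module.Dual ℝ (TangentSpace (𝓡 3) p)) =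
        0 := by
      rw [h0]; rfl
    unfold gradNorm
    rw [h1]
    exact Real.sqrt_zero

variable [T2Space X] [LocallyCompactSpace X] [MeasurableSpace X] [BorelSpace X]

/-- **Null sets of the Riemannian measure are Lebesgue-null in charts** (converse of
`riemannianMeasure_source_inter_preimage_eq_zero`): if `B` is a measurable subset of the chart
target with `μ_h(φ.source ∩ φ⁻¹ B) = 0` then `B` is Lebesgue-null (the density `√det h_{ij}` of
`φ_* μ_h` is positive on the target). [folklore] -/
theorem volume_eq_zero_of_riemannianMeasure_source_inter_preimage_eq_zero (x₀ : X) {B : Set E3}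
    (hB : MeasurableSet B) (hBt : B ⊆ (extChartAt (𝓡 3) x₀).target)
    (h0 : riemannianMeasure h ((extChartAt (𝓡 3) x₀).source ∩ extChartAt (𝓡 3) x₀ ⁻¹' B) = 0) :
    volume B = 0 := by
  have hs : MeasurableSet (extChartAt (𝓡 3) x₀).source :=
    (isOpen_extChartAt_source x₀).measurableSet
  rw [inter_comm, ← Measure.restrict_apply' hs,
    ← Measure.map_apply_of_aemeasurable (aemeasurable_extChartAt_restrict x₀ _) hB,
    map_extChartAt_restrict_riemannianMeasure h x₀, withDensity_apply _ hB,
    Measure.restrict_restrict hB, inter_eq_left.2 hBt,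
    lintegral_eq_zero_iff' ((aemeasurable_ofReal_sqrt_det_chartGramMatrix h x₀).mono_measure
      (Measure.restrict_mono hBt le_rfl))] at h0
  rw [measure_eq_zero_iff_ae_notMem]
  have h1 : ∀ᵐ y ∂(volume : Measure E3), y ∈ B →
      ENNReal.ofReal (Real.sqrt (chartGramMatrix h x₀ y).det) = 0 := (ae_restrict_iff' hB).1 h0
  filter_upwards [h1] with y hy hyB
  have hpos := sqrt_det_chartGramMatrix_pos h x₀ (hBt hyB)
  have := hy hyB
  rw [ENNReal.ofReal_eq_zero] at this
  exact absurd this (not_le.2 hpos)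

variable [SecondCountableTopology X]

/-- **Locally Lipschitz functions with a.e.-vanishing differential are locally constant.** If `u`
is locally Lipschitz on the open set `W` and `du = 0` at `μ_h`-a.e. point of `W`, then `u` is
constant near every point of `W`: in a chart, `u ∘ φ⁻¹` extends to a Lipschitz `F` on `ℝ³` whose
gradient vanishes a.e. on the open set `φ(U)` (null sets transfer in both directions between `μ_h`
and Lebesgue measure), so `F` is locally constant there (`eq_on_ball_of_ae_fderiv_eq_zero`). This is
the step "then `u` and `v` are constant on each component of `{v > u}`" of Huisken–Ilmanen's proof
of Thm. 2.2 (i) (and "u is constant on each connected component" in the proof of Lemma 1.4 (ii)).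
[cite: HuiskenIlmanenIMCF2001, proof of Thm. 2.2 (i)] -/
theorem IsLocLipschitzOn.eventuallyEq_const_of_ae_mfderiv_eq_zero {u : X → ℝ} {W : Set X}
    (hu : IsLocLipschitzOn h u W) (hW : IsOpen W)
    (h0 : ∀ᵐ p ∂(riemannianMeasure h), p ∈ W → mfderiv (𝓡 3) 𝓘(ℝ, ℝ) u p = 0)
    {p : X} (hp : p ∈ W) : u =ᶠ[𝓝 p] fun _ ↦ u p := by
  obtain ⟨U, hUo, hpU, hUW, hUs, K, hK⟩ := hu.exists_lipschitzOnWith_chart h hW hp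
  set φ := extChartAt (𝓡 3) p with hφ
  have hS : IsOpen (φ '' U) := by
    rw [φ.image_eq_target_inter_inv_preimage hUs]
    exact (continuousOn_extChartAt_symm p).isOpen_inter_preimage (isOpen_extChartAt_target p) hUo
  have hSt : φ '' U ⊆ φ.target := by
    rintro _ ⟨q, hq, rfl⟩; exact φ.map_source (hUs hq)
  obtain ⟨F, hF, hFeq⟩ := hK.extend_real
  -- `DF = 0` a.e. on `φ(U)`
  have hF0 : ∀ᵐ y ∂(volume : Measure E3), y ∈ φ '' U → fderiv ℝ F y = 0 := by
    set B := {y | y ∈ φ '' U ∧ fderiv ℝ F y ≠ 0} with hB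
    have hBm : MeasurableSet B :=
      hS.measurableSet.inter ((measurable_fderiv ℝ F) (measurableSet_singleton 0).compl)
    have hB0 : volume B = 0 := by
      refine volume_eq_zero_of_riemannianMeasure_source_inter_preimage_eq_zero h p hBm
        (fun y hy ↦ hSt hy.1) ?_
      have hnull : riemannianMeasure h {q | ¬ (q ∈ W → mfderiv (𝓡 3) 𝓘(ℝ, ℝ) u q = 0)} = 0 :=
        ae_iff.1 h0
      refine measure_mono_null (fun q hq ↦ ?_) hnull
      obtain ⟨hqs, hqB⟩ := hq
      simp only [mem_preimage, hB, mem_setOf_eq] at hqB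
      obtain ⟨⟨q', hq'U, hqq'⟩, hne⟩ := hqB
      have hq'q : q' = q := φ.injOn (hUs hq'U) hqs hqq'
      subst hq'q
      simp only [mem_setOf_eq, Classical.not_imp]
      refine ⟨hUW hq'U, fun hm ↦ hne ?_⟩
      have hqc : q' ∈ (chartAt E3 p).source := by rw [← extChartAt_source (𝓡 3)]; exact hUs hq'U
      have hgerm : F =ᶠ[𝓝 (φ q')] u ∘ φ.symm :=
        Filter.eventuallyEq_of_mem (hS.mem_nhds (mem_image_of_mem _ hq'U))
          fun y hy ↦ (hFeq hy).symm
      rw [hgerm.fderiv_eq]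
      exact fderiv_chart_eq_zero_of_mfderiv_eq_zero hqc hm
    rw [measure_eq_zero_iff_ae_notMem] at hB0
    filter_upwards [hB0] with y hy hyS
    by_contra hne
    exact hy ⟨hyS, hne⟩
  -- a ball around `φ p` inside `φ(U)` on which `F` is constant
  obtain ⟨r, hr, hball⟩ := Metric.isOpen_iff.1 hS (φ p) (mem_image_of_mem _ hpU)
  have hconst := eq_on_ball_of_ae_fderiv_eq_zero hF hS hF0 hball
  -- pull back to `X`
  have hpre : φ ⁻¹' ball (φ p) (r / 2) ∈ 𝓝 p :=
    (continuousAt_extChartAt p).preimage_mem_nhds (isOpen_ball.mem_nhds (mem_ball_self (by positivity)))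
  filter_upwards [hpre, hUo.mem_nhds hpU] with q hq hqU
  have h1 : u q = F (φ q) := by
    rw [← hFeq (mem_image_of_mem _ hqU), Function.comp_apply, φ.left_inv (hUs hqU)]
  have h2 : u p = F (φ p) := by
    rw [← hFeq (mem_image_of_mem _ hpU), Function.comp_apply, φ.left_inv (hUs hpU)]
  rw [h1, h2]
  exact hconst _ hq

/-- Slope form: if `u` is locally Lipschitz on the open set `W` and `|∇u| = 0` at `μ_h`-a.e. point
of `W`, then `u` is constant near every point of `W`. [cite: HuiskenIlmanenIMCF2001, proof of Thm. 2.2 (i)] -/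
theorem IsLocLipschitzOn.eventuallyEq_const_of_ae_gradNorm_eq_zero {u : X → ℝ} {W : Set X}
    (hu : IsLocLipschitzOn h u W) (hW : IsOpen W)
    (h0 : ∀ᵐ p ∂(riemannianMeasure h), p ∈ W → gradNorm h u p = 0)
    {p : X} (hp : p ∈ W) : u =ᶠ[𝓝 p] fun _ ↦ u p :=
  hu.eventuallyEq_const_of_ae_mfderiv_eq_zero h hW
    (h0.mono fun _ hq hqW ↦ (gradNorm_eq_zero_iff h).1 (hq hqW)) hp

/-- **On a preconnected subset of `W` such a function is constant.** If `u` is locally Lipschitz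
on the open set `W` with `|∇u| = 0` a.e. on `W`, and `C ⊆ W` is preconnected, then `u` is
constant on `C` ("`u` is constant on each connected component", Huisken–Ilmanen, proofs of
Lemma 1.4 (ii) and Thm. 2.2 (i)). [cite: HuiskenIlmanenIMCF2001, proof of Thm. 2.2 (i)] -/
theorem IsLocLipschitzOn.eq_of_isPreconnected_of_ae_gradNorm_eq_zero {u : X → ℝ} {W C : Set X}
    (hu : IsLocLipschitzOn h u W) (hW : IsOpen W)
    (h0 : ∀ᵐ p ∂(riemannianMeasure h), p ∈ W → gradNorm h u p = 0)
    (hC : IsPreconnected C) (hCW : C ⊆ W) {x y : X} (hx : x ∈ C) (hy : y ∈ C) : u x = u y := by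
  by_contra hne
  set a := u x with ha
  have hloc := fun q (hq : q ∈ W) ↦ hu.eventuallyEq_const_of_ae_gradNorm_eq_zero h hW h0 hq
  -- the open sets where `u = a` resp. `u ≠ a` locally
  set V₁ := interior {z | u z = a} with hV₁
  set V₂ := interior {z | u z ≠ a} with hV₂
  have hcover : C ⊆ V₁ ∪ V₂ := by
    intro z hz
    by_cases hza : u z = a
    · refine Or.inl (mem_interior_iff_mem_nhds.2 ?_)
      filter_upwards [hloc z (hCW hz)] with q hq
      exact hq.trans hza
    · refine Or.inr (mem_interior_iff_mem_nhds.2 ?_)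
      filter_upwards [hloc z (hCW hz)] with q hq
      exact fun hqa ↦ hza (hq.symm.trans hqa)
  have h1 : (C ∩ V₁).Nonempty := ⟨x, hx, mem_interior_iff_mem_nhds.2 (by
    filter_upwards [hloc x (hCW hx)] with q hq
    exact hq)⟩
  have h2 : (C ∩ V₂).Nonempty := ⟨y, hy, mem_interior_iff_mem_nhds.2 (by
    filter_upwards [hloc y (hCW hy)] with q hq
    exact fun hqa ↦ hne (hqa.symm.trans hq))⟩
  obtain ⟨z, -, hz1, hz2⟩ := hC V₁ V₂ isOpen_interior isOpen_interior hcover h1 h2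
  have e1 : u z = a := interior_subset (s := {z | u z = a}) hz1
  have e2 : u z ≠ a := interior_subset (s := {z | u z ≠ a}) hz2
  exact e2 e1

end Manifold

end Literature.Geometry.Lorentzian

end
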